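import Mathlib
import Literature.NumberTheory.LFunctions.Zhang2022.Section15U056Edge
import Literature.NumberTheory.LFunctions.Zhang2022.Section15RhoAlgebra
import Literature.NumberTheory.LFunctions.Zhang2022.Section15RhoProductsRate
import Literature.NumberTheory.LFunctions.Zhang2022.Section15Eq1523Edge
import HarnessLib

/-!
# Zhang (2022) §15 p. 88: u056 from u050, u055, u035 and Lemmas 15.2–15.3 at the rate `O(1/𝓛)`, and
# (15.23)/(15.24) along it

Topic `Literature/NumberTheory/LFunctions/Zhang2022` (Landau–Siegel audit tree; verdict-neutral).
Y. Zhang, *Discrete mean estimates and the Landau–Siegel zero*, arXiv:2211.02515v1 (2022)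
[Zhang2022LandauSiegel] — an unrefereed manuscript under adjudication (cell siegel-zhang, D-0069,
discharge lane, node `Skeleton.Ded1524`). §15 p. 88 (tex L4363–L4365): "This [u055: `Σ_{n<T}
χ(n)τ₂(n)ϖ₁ⱼ(n)/n = L′(1,χ)²𝒰(1) + O(α₁)`] together with Lemma 15.2 [`𝓜₁(1,1;s) = e_M + O(α₁)`]
and 15.3 [`𝒰(1) = φ(D)²D⁻²e_U + O(α₁)`, `𝒰` bounded] yields `𝓜₁(1,1;1−βⱼ)Σ_{n∈𝒩(𝒬),n<T}… =
𝔞φ(D)/D + O(1/𝓛³)` [u056], since `φ(D)D⁻¹∏_{(q,D)=1}(1−q⁻²) = (6/π²)∏_{q∣D}q/(q+1)` [u057]" — with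
the remark before it, u050: `Σ_{n∉𝒩(𝒬),n<T}… ≪ 1/𝓛`. KERNEL-CHECKED here for the landed
instantiation `Typed.Section15C.inputs15AB`:

* `u056_rate1_of_parts` — from `Step15_u050`, `Lemma152`, `Lemma153` (continuation `U` bounded +
  u053), `Step15_u055` and `Typed.Section15B.Step15_u035` (`𝓜₁(1,1;s) ≪ 1`, `σ > 9/10`): **u056
  with the error `O(1/𝓛)`** — the rate the inputs support (u050's `O(1/𝓛)` dominates; the printed
  `O(1/𝓛³)` is not derived, recorded as a gap candidate); the main term is EXACT by
  `Ded1524.mainTerm_u056` (the Euler-product merge of `Section15U056Edge`);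
* `eq15_23R_of_parts` — hence (15.23) with `O(1/𝓛)` (`Eq15_23R`) from (15.22) and the above;
* `eval1524_of_displays_R2` / `ded1524_of_displays_R2` — (15.24) = `Skeleton.Eval1524 c′` and the
  coarse leaf `Skeleton.Ded1524 c′` from the typed displays (15.6), (15.17), (15.22), u050, u055,
  u035, Lemmas 15.2–15.3, u058, u059 (via `Ded1524.eval1524_of_rates_R`, `prod_rate5_of_values`).

WHAT THIS IS NOT: proofs of those input displays (CLAIM nodes; Lemmas 15.2–15.3 are sz-d52's
Appendix-A discharges), nor any claim about Theorems 1–2 of the manuscript or Landau–Siegel zeros.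

## References
* Y. Zhang, arXiv:2211.02515v1 (2022), §15 pp. 87–88. [cite: Zhang2022LandauSiegel, §15 p.88]
-/

noncomputable section

open Complex Real ComplexConjugate Filter
open Literature.NumberTheory.LFunctions.Zhang2022.Skeleton
open Literature.NumberTheory.LFunctions.Zhang2022.Typed

namespace Literature.NumberTheory.LFunctions.Zhang2022.Ded1524

/-- `log D ≥ M` once `D ≥ ⌈e^M⌉`. [folklore] -/
private theorem le_ell_of_ceil_exp_le₃ {M : ℝ} {D : ℕ} (hD : ⌈Real.exp M⌉₊ ≤ D) : M ≤ ell D := by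
  have h : Real.exp M ≤ D := le_trans (Nat.le_ceil _) (by exact_mod_cast hD)
  exact (Real.le_log_iff_exp_le (lt_of_lt_of_le (Real.exp_pos _) h)).mpr h

/-- `β₁, β₂, β₃` by the index convention. [cite: Zhang2022LandauSiegel, §8 p.17] -/
private theorem betaJ_vals₃ (c' : ℝ) (D : ℕ) :
    betaJ c' D 1 = beta1 c' D ∧ betaJ c' D 2 = beta2 c' D ∧ betaJ c' D 3 = beta3 c' D := by
  simp [betaJ]

/-- For `|θ| ≤ 1/14` (`θ = c′α𝓛`) and `1 ≤ j ≤ 3`: `‖βⱼ‖ < 5α` and `Re βⱼ = 0` (so `s = 1 − βⱼ` is in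
the range of Lemma 15.2 and on the line `Re s = 1 > 9/10` of u035). [cite: Zhang2022LandauSiegel, §2 (2.13)] -/
theorem betaJ_norm_lt (c' : ℝ) {D : ℕ} (hα : 0 < alpha D) (hθ : |c' * alpha D * ell D| ≤ 1 / 14)
    {j : ℕ} (hj : j ∈ ({1, 2, 3} : Finset ℕ)) :
    ‖betaJ c' D j‖ < 5 * alpha D ∧ (betaJ c' D j).re = 0 := by
  obtain ⟨e1, e2, e3⟩ := beta_eq_b_mul_I c' D
  obtain ⟨b1v, b2v, b3v⟩ := betaJ_vals₃ c' D
  have hθ' := abs_le.mp hθ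
  have nI : ∀ p : ℝ, ‖(p : ℂ) * I‖ = |p| := fun p => by
    rw [norm_mul, Complex.norm_I, mul_one, Complex.norm_real, Real.norm_eq_abs]
  have reI : ∀ p : ℝ, ((p : ℂ) * I).re = 0 := fun p => by simp
  simp only [Finset.mem_insert, Finset.mem_singleton] at hj
  rcases hj with rfl | rfl | rfl
  · rw [b1v, e1, nI, reI, b1]
    refine ⟨?_, rfl⟩
    rw [show alpha D * (1 - 5 * c' * alpha D * ell D) = alpha D * (1 - 5 * (c' * alpha D * ell D))
      by ring, abs_mul, abs_of_pos hα]
    have : |1 - 5 * (c' * alpha D * ell D)| < 5 := by rw [abs_lt]; constructor <;> linarith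
    nlinarith
  · rw [b2v, e2, nI, reI, b2]
    refine ⟨?_, rfl⟩
    rw [show 2 * alpha D * (1 + c' * alpha D * ell D) = alpha D * (2 * (1 + c' * alpha D * ell D))
      by ring, abs_mul, abs_of_pos hα]
    have : |2 * (1 + c' * alpha D * ell D)| < 5 := by rw [abs_lt]; constructor <;> linarith
    nlinarith
  · rw [b3v, e3, nI, reI, b3]
    refine ⟨?_, rfl⟩
    rw [show 3 * alpha D * (1 - c' * alpha D * ell D) = alpha D * (3 * (1 - c' * alpha D * ell D))
      by ring, abs_mul, abs_of_pos hα]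
    have : |3 * (1 - c' * alpha D * ell D)| < 5 := by rw [abs_lt]; constructor <;> linarith
    nlinarith

/-- `Σ_{n<T} = Σ_{n∈𝒩(𝒬),n<T} + Σ_{n∉𝒩(𝒬),n<T}` (the two remarks after (15.22) split the sum).
[cite: Zhang2022LandauSiegel, §15 p.87] -/
theorem sumLtT_eq (c' : ℝ) (X : Section15C.Inputs15AB) {D : ℕ} [NeZero D]
    (χ : DirichletCharacter ℂ D) (j : ℕ) :
    Section15C.sumLtT c' X χ j = Section15C.sumInN c' X χ j + Section15C.sumNotInN c' X χ j := by
  classical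
  rw [Section15C.sumLtT, Section15C.sumInN, Section15C.sumNotInN]
  rw [← Finset.sum_filter_add_sum_filter_not (Finset.Ico 1 ⌈bigT D⌉₊) (fun n => n ∈ nset (frakq D))]

/-- **u056 at the rate `O(1/𝓛)` from u050, u055, u035 and Lemmas 15.2–15.3** (§15 p.88, tex
L4363–L4365, for the landed instantiation `inputs15AB`): `‖𝓜₁(1,1;1−βⱼ)·Σ_{n∈𝒩(𝒬),n<T}
χ(n)τ₂(n)ϖ₁ⱼ(n)/n − 𝔞φ(D)/D‖ ≤ C/𝓛`. The printed display claims `O(1/𝓛³)`; what the cited inputs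
give is `O(1/𝓛)` (u050) `+ O(α₁𝓛⁴)` (u055, Lemmas 15.2–15.3 against `|L′(1,χ)|² ≪ 𝓛⁴`), the main
term being exact (`mainTerm_u056`). [cite: Zhang2022LandauSiegel, §15 p.88] -/
theorem u056_rate1_of_parts (c' : ℝ) (h50 : Section15C.Step15_u050 c' Section15C.inputs15AB)
    (h152 : Section15C.Lemma152 c' Section15C.inputs15AB)
    (h153 : Section15C.Lemma153 c' Section15C.inputs15AB)
    (h55 : Section15C.Step15_u055 c' Section15C.inputs15AB)
    (h35 : Section15B.Step15_u035 c') :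
    ∃ C : ℝ, ForAllLarge fun D _ χ => AssumptionA D χ → ∀ j ∈ ({1, 2, 3} : Finset ℕ),
      ‖Section15C.inputs15AB.calM1 c' χ 1 1 (1 - betaJ c' D j) *
          Section15C.sumInN c' Section15C.inputs15AB χ j -
        (frakA χ : ℂ) * (Nat.totient D : ℂ) / (D : ℂ)‖ ≤ C / ell D := by
  obtain ⟨C₅, h50⟩ := h50
  obtain ⟨C₁, h152⟩ := h152
  obtain ⟨⟨C₂, h153a⟩, ⟨C₃, h153b⟩⟩ := h153
  obtain ⟨C₄, h55⟩ := h55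
  obtain ⟨c₆, C₆, h35⟩ := h35
  -- threshold: `𝓛 ≥ 3` and `𝓛 ≥ 14|c'|π + 1` (so that `|θ| ≤ 1/14`)
  set M : ℝ := max 3 (14 * |c'| * π + 1) with hM
  have hT : ForAllLarge fun D _ _ => M ≤ ell D :=
    ForAllLarge.of_le ⌈Real.exp M⌉₊ fun D _ _ hD _ _ => le_ell_of_ceil_exp_le₃ hD
  set K : ℝ := |C₆| * |C₅| + |C₆| * |C₄| * π +
    (4 * Real.exp (9 / 2)) ^ 2 * π * (|C₆| * |C₃| + |C₁| * (|C₂| + |C₃| * π)) with hK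
  obtain ⟨D₀, h⟩ := (((((h50.and h152).and h153a).and h153b).and h55).and h35).and hT
  refine ⟨K, D₀, fun D _ χ hD hq hp hA j hj => ?_⟩
  obtain ⟨⟨⟨⟨⟨⟨g50, g152⟩, g153a⟩, g153b⟩, g55⟩, g35⟩, hMℓ⟩ := h D χ hD hq hp
  have hℓ3 : 3 ≤ ell D := (le_max_left _ _).trans hMℓ
  have hℓc : 14 * |c'| * π + 1 ≤ ell D := (le_max_right _ _).trans hMℓ
  have hℓ1 : 1 ≤ ell D := by linarith
  have hℓ0 : 0 < ell D := by linarith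
  have hD3 : 3 ≤ D := by
    by_contra hlt
    have : (D : ℝ) < 3 := by exact_mod_cast not_le.mp hlt
    have hD0 : 0 < (D : ℝ) := by exact_mod_cast Nat.pos_of_ne_zero (NeZero.ne D)
    have : ell D < 3 := by
      calc ell D = Real.log D := rfl
        _ < Real.log (Real.exp 3) := Real.log_lt_log hD0 (by
            have := Real.add_one_le_exp (3:ℝ); linarith)
        _ = 3 := Real.log_exp 3
    linarith
  -- `α`, `θ`
  have hα : alpha D = π / ell D ^ 9 := by rw [alpha, bigP, Real.log_exp]
  have hαpos : 0 < alpha D := by rw [hα]; positivity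
  have hα1 : alpha D * ell D = π / ell D ^ 8 := by rw [hα]; field_simp
  have hαℓle : alpha D * ell D ≤ π := by
    rw [hα1]; exact div_le_self Real.pi_pos.le (one_le_pow₀ hℓ1)
  have hθ : |c' * alpha D * ell D| ≤ 1 / 14 := by
    rw [abs_mul, abs_mul, abs_of_pos hαpos, abs_of_pos hℓ0, mul_assoc, hα1,
      show |c'| * (π / ell D ^ 8) = |c'| * π / ell D ^ 8 by ring,
      div_le_div_iff₀ (by positivity) (by norm_num)]
    have h8 : ell D ≤ ell D ^ 8 := by
      calc ell D = ell D ^ 1 := (pow_one _).symm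
        _ ≤ ell D ^ 8 := pow_le_pow_right₀ hℓ1 (by norm_num)
    nlinarith [abs_nonneg c', Real.pi_pos]
  obtain ⟨hβ5, hβre⟩ := betaJ_norm_lt c' hαpos hθ hj
  -- the inputs at `(D, χ, j)`
  set s : ℂ := 1 - betaJ c' D j with hs
  have hs1 : ‖s - 1‖ < 5 * alpha D := by rw [hs, sub_sub_cancel_left, norm_neg]; exact hβ5
  have hsre : 9 / 10 < s.re := by rw [hs, Complex.sub_re, Complex.one_re, hβre]; norm_num
  have e152 : ‖Section15C.inputs15AB.calM1 c' χ 1 1 s - Section15C.eulerM1 χ‖ ≤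
      C₁ * (alpha D * ell D) := g152 hA s hs1
  obtain ⟨U, hU, hUb⟩ := g153a hA j hj
  have e153b : ‖U 1 - (Nat.totient D : ℂ) ^ 2 / (D : ℂ) ^ 2 * Section15C.eulerU1 χ‖ ≤
      C₃ * (alpha D * ell D) := g153b hA j hj U hU
  have e55 : ‖Section15C.sumLtT c' Section15C.inputs15AB χ j - deriv χ.LFunction 1 ^ 2 * U 1‖ ≤
      C₄ * (alpha D * ell D) := g55 hA j hj U hU
  have e50 : ‖Section15C.sumNotInN c' Section15C.inputs15AB χ j‖ ≤ C₅ / ell D := g50 hA j hj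
  have e35 : ‖Section15C.inputs15AB.calM1 c' χ 1 1 s‖ ≤ C₆ := by
    have h := g35 hA 1 1 le_rfl le_rfl s hsre
    rw [Section15C.inputs15AB_calM1]
    simpa using h
  have eU1 : ‖U 1‖ ≤ C₂ := hUb 1 (by norm_num)
  have hLup : ‖deriv χ.LFunction 1‖ ≤ 4 * Real.exp (9 / 2) * ell D ^ 2 := by
    have h := Lemma31.norm_deriv_LFunction_le_near_one χ (by rw [ell] at hℓ3; exact hℓ3) hp
      (w := 1) (by simp; positivity)
    calc ‖deriv χ.LFunction 1‖ ≤ 2 * Real.exp (9 / 2) * (1 + Real.log D) * Real.log D := h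
      _ ≤ 2 * Real.exp (9 / 2) * (ell D + ell D) * ell D := by rw [ell] at hℓ1 ⊢; gcongr
      _ = 4 * Real.exp (9 / 2) * ell D ^ 2 := by ring
  -- the exact main term and the pointwise bookkeeping
  have hmain := mainTerm_u056 χ hp hq hD3
  have hP := u056_pointwise (ε₁ := |C₁| * (alpha D * ell D)) (ε₃ := |C₃| * (alpha D * ell D))
    (ε₄ := |C₄| * (alpha D * ell D)) (ε₅ := |C₅| / ell D) (C₂ := |C₂|) (C₆ := |C₆|)
    (e152.trans (by gcongr; exact le_abs_self C₁)) (e153b.trans (by gcongr; exact le_abs_self C₃))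
    (e55.trans (by gcongr; exact le_abs_self C₄)) (e50.trans (by gcongr; exact le_abs_self C₅))
    (e35.trans (le_abs_self C₆)) (eU1.trans (le_abs_self C₂)) hLup hmain
  have hIn : Section15C.sumInN c' Section15C.inputs15AB χ j =
      Section15C.sumLtT c' Section15C.inputs15AB χ j -
        Section15C.sumNotInN c' Section15C.inputs15AB χ j := by
    rw [sumLtT_eq]; ring
  rw [hIn]
  refine hP.trans ?_
  -- collect: everything is `≤ K/𝓛`
  have hαℓ0 : 0 ≤ alpha D * ell D := by positivity
  have t1 : |C₆| * (|C₅| / ell D) = |C₆| * |C₅| * (1 / ell D) := by ring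
  have t2 : |C₆| * (|C₄| * (alpha D * ell D)) ≤ |C₆| * |C₄| * π * (1 / ell D) := by
    rw [hα1]
    have : 1 / ell D ^ 8 ≤ 1 / ell D :=
      one_div_le_one_div_of_le hℓ0 (by
        calc ell D = ell D ^ 1 := (pow_one _).symm
          _ ≤ ell D ^ 8 := pow_le_pow_right₀ hℓ1 (by norm_num))
    calc |C₆| * (|C₄| * (π / ell D ^ 8)) = |C₆| * |C₄| * π * (1 / ell D ^ 8) := by ring
      _ ≤ |C₆| * |C₄| * π * (1 / ell D) := by gcongr
  have t3 : (4 * Real.exp (9 / 2) * ell D ^ 2) ^ 2 *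
      (|C₆| * (|C₃| * (alpha D * ell D)) + |C₁| * (alpha D * ell D) * (|C₂| + |C₃| * (alpha D * ell D)))
      ≤ (4 * Real.exp (9 / 2)) ^ 2 * π * (|C₆| * |C₃| + |C₁| * (|C₂| + |C₃| * π)) * (1 / ell D) := by
    have h4 : ell D ^ 4 * (alpha D * ell D) = π * (1 / ell D ^ 4) := by rw [hα1]; field_simp
    have i4 : 1 / ell D ^ 4 ≤ 1 / ell D :=
      one_div_le_one_div_of_le hℓ0 (by
        calc ell D = ell D ^ 1 := (pow_one _).symm
          _ ≤ ell D ^ 4 := pow_le_pow_right₀ hℓ1 (by norm_num))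
    have inner : |C₆| * (|C₃| * (alpha D * ell D)) + |C₁| * (alpha D * ell D) *
        (|C₂| + |C₃| * (alpha D * ell D)) ≤
        (|C₆| * |C₃| + |C₁| * (|C₂| + |C₃| * π)) * (alpha D * ell D) := by
      have : |C₁| * (alpha D * ell D) * (|C₃| * (alpha D * ell D)) ≤
          |C₁| * (alpha D * ell D) * (|C₃| * π) := by gcongr
      nlinarith [abs_nonneg C₆, abs_nonneg C₃, abs_nonneg C₁, abs_nonneg C₂]
    calc (4 * Real.exp (9 / 2) * ell D ^ 2) ^ 2 * (|C₆| * (|C₃| * (alpha D * ell D)) +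
          |C₁| * (alpha D * ell D) * (|C₂| + |C₃| * (alpha D * ell D)))
        ≤ (4 * Real.exp (9 / 2) * ell D ^ 2) ^ 2 *
            ((|C₆| * |C₃| + |C₁| * (|C₂| + |C₃| * π)) * (alpha D * ell D)) := by gcongr
      _ = (4 * Real.exp (9 / 2)) ^ 2 * (|C₆| * |C₃| + |C₁| * (|C₂| + |C₃| * π)) *
            (ell D ^ 4 * (alpha D * ell D)) := by ring
      _ = (4 * Real.exp (9 / 2)) ^ 2 * (|C₆| * |C₃| + |C₁| * (|C₂| + |C₃| * π)) *
            (π * (1 / ell D ^ 4)) := by rw [h4]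
      _ = (4 * Real.exp (9 / 2)) ^ 2 * π * (|C₆| * |C₃| + |C₁| * (|C₂| + |C₃| * π)) *
            (1 / ell D ^ 4) := by ring
      _ ≤ (4 * Real.exp (9 / 2)) ^ 2 * π * (|C₆| * |C₃| + |C₁| * (|C₂| + |C₃| * π)) *
            (1 / ell D) := by gcongr
  have hKd : K / ell D = K * (1 / ell D) := div_eq_mul_one_div _ _
  rw [hKd, hK]
  linarith

/-! ## (15.23) with `O(1/𝓛)` and (15.24) from the finer displays -/

/-- (15.22) + [u056 at rate `O(1/𝓛)`] ⇒ (15.23) with `O(1/𝓛)` (`Eq15_23R`), for any instantiation `X`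
(the twin of `eq15_23R_of_eq15_22`, which takes the printed u056). [cite: Zhang2022LandauSiegel, §15 (15.23) p.88] -/
theorem eq15_23R_of_eq15_22_rate1 (c' : ℝ) (X : Section15C.Inputs15AB) (h22 : Section15C.Eq15_22 c' X)
    (h56 : ∃ C : ℝ, ForAllLarge fun D _ χ => AssumptionA D χ → ∀ j ∈ ({1, 2, 3} : Finset ℕ),
      ‖X.calM1 c' χ 1 1 (1 - betaJ c' D j) * Section15C.sumInN c' X χ j -
        (frakA χ : ℂ) * (Nat.totient D : ℂ) / (D : ℂ)‖ ≤ C / ell D) :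
    Section15C.Eq15_23R c' X := by
  obtain ⟨C, hC⟩ := h22
  obtain ⟨C', hC'⟩ := h56
  set K : ℝ := ‖frake 1‖ + ‖frake 2‖ + ‖frake 3‖ with hK
  obtain ⟨D₀, h⟩ := hC.and hC'
  refine ⟨|C| + K * |C'|, D₀, fun D _ χ hD hq hp hA j hj => ?_⟩
  obtain ⟨h1, h2⟩ := h D χ hD hq hp
  have g1 := h1 hA j hj
  have g2 := h2 hA j hj
  have hℓ : 0 ≤ ell D := Real.log_natCast_nonneg D
  have hKj : ‖frake j‖ ≤ K := by
    simp only [Finset.mem_insert, Finset.mem_singleton] at hj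
    rcases hj with rfl | rfl | rfl <;> simp only [hK] <;> linarith [norm_nonneg (frake 1),
      norm_nonneg (frake 2), norm_nonneg (frake 3)]
  set Mv : ℂ := X.calM1 c' χ 1 1 (1 - betaJ c' D j) * Section15C.sumInN c' X χ j with hMv
  have key : X.calS1 c' χ j - frake j * (frakA χ : ℂ) * (Nat.totient D : ℂ) / (D : ℂ) =
      (X.calS1 c' χ j - frake j * X.calM1 c' χ 1 1 (1 - betaJ c' D j) * Section15C.sumInN c' X χ j) +
        frake j * (Mv - (frakA χ : ℂ) * (Nat.totient D : ℂ) / (D : ℂ)) := by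
    rw [hMv]; ring
  rw [key]
  have e1 : ‖X.calS1 c' χ j - frake j * X.calM1 c' χ 1 1 (1 - betaJ c' D j) *
      Section15C.sumInN c' X χ j‖ ≤ |C| / ell D := g1.trans (by gcongr; exact le_abs_self C)
  have e2 : ‖frake j * (Mv - (frakA χ : ℂ) * (Nat.totient D : ℂ) / (D : ℂ))‖ ≤ K * (|C'| / ell D) := by
    rw [norm_mul]
    exact mul_le_mul hKj (g2.trans (by gcongr; exact le_abs_self C')) (norm_nonneg _) (by positivity)
  calc ‖(X.calS1 c' χ j - frake j * X.calM1 c' χ 1 1 (1 - betaJ c' D j) * Section15C.sumInN c' X χ j) +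
        frake j * (Mv - (frakA χ : ℂ) * (Nat.totient D : ℂ) / (D : ℂ))‖
      ≤ |C| / ell D + K * (|C'| / ell D) := (norm_add_le _ _).trans (add_le_add e1 e2)
    _ = (|C| + K * |C'|) / ell D := by ring

/-- **(15.23) with `O(1/𝓛)` from the typed displays (15.22), u050, Lemma 15.2, Lemma 15.3, u055 and
u035** (instance `inputs15AB`). [cite: Zhang2022LandauSiegel, §15 (15.23) p.88] -/
theorem eq15_23R_of_parts (c' : ℝ) (h22 : Section15C.Eq15_22 c' Section15C.inputs15AB)
    (h50 : Section15C.Step15_u050 c' Section15C.inputs15AB)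
    (h152 : Section15C.Lemma152 c' Section15C.inputs15AB)
    (h153 : Section15C.Lemma153 c' Section15C.inputs15AB)
    (h55 : Section15C.Step15_u055 c' Section15C.inputs15AB)
    (h35 : Section15B.Step15_u035 c') : Section15C.Eq15_23R c' Section15C.inputs15AB :=
  eq15_23R_of_eq15_22_rate1 c' _ h22 (u056_rate1_of_parts c' h50 h152 h153 h55 h35)

/-- **(15.24) = `Skeleton.Eval1524 c′` from the typed displays (15.6), (15.17), (15.22), u050,
Lemma 15.2, Lemma 15.3, u055, u035, u058, u059** — i.e. with u056 and (15.23) BYPASSED (their printed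
rates `O(𝓛⁻³)` replaced by the derived `O(1/𝓛)`, which suffices: `eval1524_of_rates_R`).
[cite: Zhang2022LandauSiegel, §15 (15.24) p.88] -/
theorem eval1524_of_displays_R2 (c' : ℝ) (h6 : Section15A.Eq15_6 c' Section15A.bLit)
    (h17 : Section15B.Eq15_17 c' Section15A.bLit)
    (h22 : Section15C.Eq15_22 c' Section15C.inputs15AB)
    (h50 : Section15C.Step15_u050 c' Section15C.inputs15AB)
    (h152 : Section15C.Lemma152 c' Section15C.inputs15AB)
    (h153 : Section15C.Lemma153 c' Section15C.inputs15AB)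
    (h55 : Section15C.Step15_u055 c' Section15C.inputs15AB)
    (h35 : Section15B.Step15_u035 c')
    (h58 : Section15C.Step15_u058 c' Section15C.inputs15AB)
    (h59 : Section15C.Step15_u059 c' Section15C.inputs15AB) : Eval1524 c' :=
  eval1524_of_rates_R
    (Φp := fun D _ χ p => Section15A.Phi1pOf c' χ (Section15A.bLit D χ) p)
    (S := fun D _ χ j => Section15B.calS1 c' χ (Section15A.bLit D χ) j)
    (R := fun _ _ χ j => Section15B.calR1 c' χ j)
    (Rs := fun _ _ χ => Section15A.calR1star c' χ)
    h6 h17 (eq15_23R_of_parts c' h22 h50 h152 h153 h55 h35) (prod_rate5_of_values c' h58 h59)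

/-- The banked coarse node `Skeleton.Ded1524 c′` from the same ten typed displays.
[cite: Zhang2022LandauSiegel, §15 (15.1)–(15.24)] -/
theorem ded1524_of_displays_R2 (c' : ℝ) (h6 : Section15A.Eq15_6 c' Section15A.bLit)
    (h17 : Section15B.Eq15_17 c' Section15A.bLit)
    (h22 : Section15C.Eq15_22 c' Section15C.inputs15AB)
    (h50 : Section15C.Step15_u050 c' Section15C.inputs15AB)
    (h152 : Section15C.Lemma152 c' Section15C.inputs15AB)
    (h153 : Section15C.Lemma153 c' Section15C.inputs15AB)
    (h55 : Section15C.Step15_u055 c' Section15C.inputs15AB)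
    (h35 : Section15B.Step15_u035 c')
    (h58 : Section15C.Step15_u058 c' Section15C.inputs15AB)
    (h59 : Section15C.Step15_u059 c' Section15C.inputs15AB) : Ded1524 c' :=
  fun _ _ _ _ => eval1524_of_displays_R2 c' h6 h17 h22 h50 h152 h153 h55 h35 h58 h59

end Literature.NumberTheory.LFunctions.Zhang2022.Ded1524
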